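import Summits.ValiantsHypothesis.ValiantsHypothesis.Theorems.LacunarySymmetroidMatrixDescartesPivotRankOneFourKillSeven

/-!
# `MatrixDescartes` census — the `(2,4)₁` cell with RANK-ONE letters: the direction-only condition (P) for `Z₊ ≤ 8`
# (third kept four-set of the kill-seven argument: the four CROSS PAIRS; `J` does not enter at all)

HONEST FRAMING.  Object-search cell `pub-symmetroid`, seat `val-sym-mdr-p1` (generation 12); helper file `--supports` the crux item
stmt-ValiantsHypothesis-18050 (`Theses.LacunarySymmetroid.MatrixDescartes`, OPEN, on HOLD) with NO closure claim.  Companion of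
`…PivotRankOneFourKillSeven` ((S)) and `…PivotRankOneFourKillSevenPrime` ((S′)); engine `…PivotTwoDirectionsBlockLaw`.

**THEOREM (`rankOne_posRoots_le_eight_of_condP`, real-parameter form `elevenNomial_condP_le_eight`).**  For the rank-one pencil
`F = X^e J + ∑ₖ wₖ X^{dₖ} vₖvₖᵀ` (`d₀ < d₁ < e < d₂ < d₃`, all `wₖ > 0`, `J` ARBITRARY, `v₁ ∦ v₂`, `v₂ ∦ v₃`) with `d₁ + d₂ < 2e` (gap form
`b₃ < |b₂|`, true in chamber (B)), the DIRECTION-ONLY condition (P)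
`Δ₁₂²·Δ₀₃²·Π(d₁+d₂)·Π(d₀+d₃) ≤ Δ₀₁²·Δ₂₃²·Π(d₀+d₁)·Π(d₂+d₃)` (distance products to the killed degrees `2e, e+d₀, e+d₁, e+d₂, e+d₃,
d₀+d₂, d₁+d₃`, spelled out) gives `Z₊ ≤ 8`: kill the pivot square, all four singles and the two «diagonal» pairs; the four CROSS
pairs `d₀+d₁ < d₁+d₂ < d₀+d₃ < d₂+d₃` survive as two translated pairs (shift `d₂ − d₀`) with signs `− + − +` and all-positive original
coefficients `wₖw_lΔ_{kl}²`, so (P) is the cross-ratio hypothesis of `card_posRoots_fourNomial_le_one`.  (P) involves neither `J` nor the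
weights: it fails only when letters `0,1` or `2,3` are nearly parallel (relative to the exponent slacks).

LOCATED, NOT CLAIMED (exp/gen24b.py): (P)-type sets were the champions of the located covering over ALL exponent orders
(`P(1,3|0,2)` good in 2 990 of 3 000 samples, often by sign structure rather than by (P) itself); with (S), (S′) and the degenerate-letter
sets every located sample was covered.  The rank-one law `(2,4)₁ ≤ 8` is NOT claimed.  Nothing here bears on `MatrixDescartes` in its
window, on `DoorA26` / `DoorA34`, registers / credences, or `VP ≠ VNP`.

[folklore] As in the companions.  No definitions, no named facts.
-/

-- `Summit.ValiantsHypothesis.ValiantsHypothesis.…` repeats a component by the D-0017 layout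
-- (single-conjunct summit), which the `dupNamespace` linter flags; the name is mandated.
set_option linter.dupNamespace false

namespace Summit.ValiantsHypothesis.ValiantsHypothesis.Theorems.LacunarySymmetroidMatrixDescartes.Pivot.TwoDirections.BlockLaw

open Polynomial Matrix Finset
open scoped BigOperators

/-- **The eleven-nomial under `d₁ + d₂ < 2e` and the direction-only condition (P) has at most eight positive roots** (kept set
`{d₀+d₁, d₁+d₂, d₀+d₃, d₂+d₃}` — all PAIR terms — killed `2e, e+d₀, e+d₁, e+d₂, e+d₃, d₀+d₂, d₁+d₃`; weights positive, `D12, D23 > 0`;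
(P): `D12·D03·Π(d₁+d₂)·Π(d₀+d₃) ≤ D01·D23·Π(d₀+d₁)·Π(d₂+d₃)` — no pairing with `J` enters). -/
theorem elevenNomial_condP_le_eight (e d₀ d₁ d₂ d₃ : ℕ) (h01 : d₀ < d₁) (h1e : d₁ < e) (he2 : e < d₂) (h23 : d₂ < d₃)
    (hB2 : d₁ + d₂ < 2 * e)
    (dJ m₀ m₁ m₂ m₃ w₀ w₁ w₂ w₃ D01 D02 D03 D12 D13 D23 : ℝ) (hw₀ : 0 < w₀) (hw₁ : 0 < w₁) (hw₂ : 0 < w₂) (hw₃ : 0 < w₃)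
    (hD12 : 0 < D12) (hD23 : 0 < D23)
    (hS : D12 * D03
        * (((d₁ : ℝ) + d₂ - e - d₀) * ((d₂ : ℝ) - e) * ((d₁ : ℝ) - d₀) * ((2 : ℝ) * e - d₁ - d₂) * ((e : ℝ) - d₁) * ((e : ℝ) + d₃ - d₁ - d₂) * ((d₃ : ℝ) - d₂))
        * (((d₃ : ℝ) - e) * ((d₀ : ℝ) + d₃ - e - d₁) * ((d₃ : ℝ) - d₂) * ((d₀ : ℝ) + d₃ - 2 * e) * ((e : ℝ) + d₂ - d₀ - d₃) * ((d₁ : ℝ) - d₀) * ((e : ℝ) - d₀))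
        ≤ D01 * D23
        * (((2 : ℝ) * e - d₀ - d₁) * ((e : ℝ) - d₁) * ((e : ℝ) - d₀) * ((e : ℝ) + d₂ - d₀ - d₁) * ((e : ℝ) + d₃ - d₀ - d₁) * ((d₂ : ℝ) - d₁) * ((d₃ : ℝ) - d₀))
        * (((d₂ : ℝ) + d₃ - 2 * e) * ((d₂ : ℝ) + d₃ - e - d₀) * ((d₂ : ℝ) + d₃ - e - d₁) * ((d₃ : ℝ) - e) * ((d₂ : ℝ) - e) * ((d₃ : ℝ) - d₀) * ((d₂ : ℝ) - d₁))) :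
    ((∑ i : Fin 11, Polynomial.C ((![dJ, w₀ * m₀, w₁ * m₁, w₂ * m₂, w₃ * m₃, w₀ * w₁ * D01, w₀ * w₂ * D02, w₀ * w₃ * D03, w₁ * w₂ * D12, w₁ * w₃ * D13, w₂ * w₃ * D23] : Fin 11 → ℝ) i) * X ^ ((![2 * e, e + d₀, e + d₁, e + d₂, e + d₃, d₀ + d₁, d₀ + d₂, d₀ + d₃, d₁ + d₂, d₁ + d₃, d₂ + d₃] : Fin 11 → ℕ) i)).roots.toFinset.filter (fun t => 0 < t)).card ≤ 8 := by
  classical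
  have h01' : (d₀ : ℝ) < d₁ := by exact_mod_cast h01
  have h1e' : (d₁ : ℝ) < e := by exact_mod_cast h1e
  have he2' : (e : ℝ) < d₂ := by exact_mod_cast he2
  have h23' : (d₂ : ℝ) < d₃ := by exact_mod_cast h23
  have hB2' : (d₁ : ℝ) + d₂ < 2 * e := by exact_mod_cast hB2
  -- the four distance products (positive atoms)
  obtain ⟨PA, hPA⟩ : ∃ x : ℝ, x = ((2 : ℝ) * e - d₀ - d₁) * ((e : ℝ) - d₁) * ((e : ℝ) - d₀) * ((e : ℝ) + d₂ - d₀ - d₁) * ((e : ℝ) + d₃ - d₀ - d₁) * ((d₂ : ℝ) - d₁) * ((d₃ : ℝ) - d₀) := ⟨_, rfl⟩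
  obtain ⟨PB, hPB⟩ : ∃ x : ℝ, x = ((d₁ : ℝ) + d₂ - e - d₀) * ((d₂ : ℝ) - e) * ((d₁ : ℝ) - d₀) * ((2 : ℝ) * e - d₁ - d₂) * ((e : ℝ) - d₁) * ((e : ℝ) + d₃ - d₁ - d₂) * ((d₃ : ℝ) - d₂) := ⟨_, rfl⟩
  obtain ⟨PC, hPC⟩ : ∃ x : ℝ, x = ((d₃ : ℝ) - e) * ((d₀ : ℝ) + d₃ - e - d₁) * ((d₃ : ℝ) - d₂) * ((d₀ : ℝ) + d₃ - 2 * e) * ((e : ℝ) + d₂ - d₀ - d₃) * ((d₁ : ℝ) - d₀) * ((e : ℝ) - d₀) := ⟨_, rfl⟩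
  obtain ⟨PD, hPD⟩ : ∃ x : ℝ, x = ((d₂ : ℝ) + d₃ - 2 * e) * ((d₂ : ℝ) + d₃ - e - d₀) * ((d₂ : ℝ) + d₃ - e - d₁) * ((d₃ : ℝ) - e) * ((d₂ : ℝ) - e) * ((d₃ : ℝ) - d₀) * ((d₂ : ℝ) - d₁) := ⟨_, rfl⟩
  have hS' : D12 * D03 * PB * PC ≤ D01 * D23 * PA * PD := by rw [hPA, hPB, hPC, hPD]; exact hS
  clear hS
  have hPBp : 0 < PB := by
    rw [hPB]
    have f1 : 0 < (d₁ : ℝ) + d₂ - e - d₀ := by linarith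
    have f2 : 0 < (d₂ : ℝ) - e := by linarith
    have f3 : 0 < (d₁ : ℝ) - d₀ := by linarith
    have f4 : 0 < (2 : ℝ) * e - d₁ - d₂ := by linarith
    have f5 : 0 < (e : ℝ) - d₁ := by linarith
    have f6 : 0 < (e : ℝ) + d₃ - d₁ - d₂ := by linarith
    have f7 : 0 < (d₃ : ℝ) - d₂ := by linarith
    exact mul_pos (mul_pos (mul_pos (mul_pos (mul_pos (mul_pos f1 f2) f3) f4) f5) f6) f7
  have hPDp : 0 < PD := by
    rw [hPD]
    have f1 : 0 < (d₂ : ℝ) + d₃ - 2 * e := by linarith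
    have f2 : 0 < (d₂ : ℝ) + d₃ - e - d₀ := by linarith
    have f3 : 0 < (d₂ : ℝ) + d₃ - e - d₁ := by linarith
    have f4 : 0 < (d₃ : ℝ) - e := by linarith
    have f5 : 0 < (d₂ : ℝ) - e := by linarith
    have f6 : 0 < (d₃ : ℝ) - d₀ := by linarith
    have f7 : 0 < (d₂ : ℝ) - d₁ := by linarith
    exact mul_pos (mul_pos (mul_pos (mul_pos (mul_pos (mul_pos f1 f2) f3) f4) f5) f6) f7
  -- the four surviving coefficients
  obtain ⟨A, hA⟩ : ∃ x : ℝ, x = w₀ * w₁ * D01 * PA := ⟨_, rfl⟩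
  obtain ⟨B, hB⟩ : ∃ x : ℝ, x = w₁ * w₂ * D12 * PB := ⟨_, rfl⟩
  obtain ⟨C, hC⟩ : ∃ x : ℝ, x = w₀ * w₃ * D03 * PC := ⟨_, rfl⟩
  obtain ⟨D, hD⟩ : ∃ x : ℝ, x = w₂ * w₃ * D23 * PD := ⟨_, rfl⟩
  have hBp : 0 < B := by rw [hB]; exact mul_pos (mul_pos (mul_pos hw₁ hw₂) hD12) hPBp
  have hDp : 0 < D := by rw [hD]; exact mul_pos (mul_pos (mul_pos hw₂ hw₃) hD23) hPDp
  have hBC : B * C ≤ A * D := by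
    have e1 : B * C = (w₀ * w₁ * w₂ * w₃) * (D12 * D03 * PB * PC) := by rw [hB, hC]; ring
    have e2 : A * D = (w₀ * w₁ * w₂ * w₃) * (D01 * D23 * PA * PD) := by rw [hA, hD]; ring
    rw [e1, e2]
    exact mul_le_mul_of_nonneg_left hS' (mul_pos (mul_pos (mul_pos hw₀ hw₁) hw₂) hw₃).le
  -- seven kills
  have hkills := card_posRoots_le_kills (Finset.univ : Finset (Fin 11)) (![2 * e, e + d₀, e + d₁, e + d₂, e + d₃, d₀ + d₁, d₀ + d₂, d₀ + d₃, d₁ + d₂, d₁ + d₃, d₂ + d₃] : Fin 11 → ℕ) [2 * e, e + d₀, e + d₁, e + d₂, e + d₃, d₀ + d₂, d₁ + d₃] (![dJ, w₀ * m₀, w₁ * m₁, w₂ * m₂, w₃ * m₃, w₀ * w₁ * D01, w₀ * w₂ * D02, w₀ * w₃ * D03, w₁ * w₂ * D12, w₁ * w₃ * D13, w₂ * w₃ * D23] : Fin 11 → ℝ)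
  -- the killed eleven-nomial is MINUS the four-nomial `A X^{d₀+d₁} − B X^{e+d₁} + C X^{d₀+d₃} − D X^{e+d₃}`
  have hfour : (∑ i ∈ (Finset.univ : Finset (Fin 11)), Polynomial.C ((![dJ, w₀ * m₀, w₁ * m₁, w₂ * m₂, w₃ * m₃, w₀ * w₁ * D01, w₀ * w₂ * D02, w₀ * w₃ * D03, w₁ * w₂ * D12, w₁ * w₃ * D13, w₂ * w₃ * D23] : Fin 11 → ℝ) i
          * (([2 * e, e + d₀, e + d₁, e + d₂, e + d₃, d₀ + d₂, d₁ + d₃]).map (fun ρ : ℕ => ((((![2 * e, e + d₀, e + d₁, e + d₂, e + d₃, d₀ + d₁, d₀ + d₂, d₀ + d₃, d₁ + d₂, d₁ + d₃, d₂ + d₃] : Fin 11 → ℕ) i : ℕ) : ℝ) - (ρ : ℝ)))).prod) * X ^ ((![2 * e, e + d₀, e + d₁, e + d₂, e + d₃, d₀ + d₁, d₀ + d₂, d₀ + d₃, d₁ + d₂, d₁ + d₃, d₂ + d₃] : Fin 11 → ℕ) i))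
      = -(Polynomial.C A * X ^ (d₀ + d₁) - Polynomial.C B * X ^ (d₀ + d₁ + (d₂ - d₀))
          + Polynomial.C C * X ^ (d₀ + d₁ + (d₃ - d₁)) - Polynomial.C D * X ^ (d₀ + d₁ + (d₂ - d₀) + (d₃ - d₁))) := by
    have e3 : d₀ + d₁ + (d₂ - d₀) + (d₃ - d₁) = d₂ + d₃ := by omega
    have e1 : d₀ + d₁ + (d₂ - d₀) = d₁ + d₂ := by omega
    have e2 : d₀ + d₁ + (d₃ - d₁) = d₀ + d₃ := by omega
    rw [e3, e1, e2]
    have hcoef : ∀ i : Fin 11, (![dJ, w₀ * m₀, w₁ * m₁, w₂ * m₂, w₃ * m₃, w₀ * w₁ * D01, w₀ * w₂ * D02, w₀ * w₃ * D03, w₁ * w₂ * D12, w₁ * w₃ * D13, w₂ * w₃ * D23] : Fin 11 → ℝ) i * (([2 * e, e + d₀, e + d₁, e + d₂, e + d₃, d₀ + d₂, d₁ + d₃]).map (fun ρ : ℕ => ((((![2 * e, e + d₀, e + d₁, e + d₂, e + d₃, d₀ + d₁, d₀ + d₂, d₀ + d₃, d₁ + d₂, d₁ + d₃, d₂ + d₃]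 : Fin 11 → ℕ) i : ℕ) : ℝ) - (ρ : ℝ)))).prod
        = (![0, 0, 0, 0, 0, -A, 0, -C, B, 0, D] : Fin 11 → ℝ) i := by
      intro i
      fin_cases i <;>
        simp only [Fin.zero_eta, Fin.mk_one, Fin.isValue, Matrix.cons_val_zero, Matrix.cons_val_one,
          List.map_cons, List.map_nil, List.prod_cons, List.prod_nil, hA, hB, hC, hD, hPA, hPB, hPC, hPD] <;>
        push_cast <;> ring
    rw [Finset.sum_congr rfl (fun i _ => by rw [hcoef i])]
    simp only [Fin.sum_univ_succ, Fin.sum_univ_zero, Matrix.cons_val_zero, Matrix.cons_val_succ, map_zero, zero_mul,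
      zero_add, add_zero, Polynomial.C_neg]
    ring
  rw [hfour, Polynomial.roots_neg] at hkills
  have hone := card_posRoots_fourNomial_le_one A B C D hBp hDp hBC (d₀ + d₁) (d₂ - d₀) (d₃ - d₁) (by omega)
  simp only [List.length_cons, List.length_nil] at hkills
  omega

/-- **RANK-ONE `(2,4)₁` WITH `d₁ + d₂ < 2e` (e.g. chamber (B)): `Z₊ ≤ 8` under the direction-only condition (P)** (matrix form; `J`
ARBITRARY — not even a pairing sign is needed; `v₁ ∦ v₂`, `v₂ ∦ v₃`). [this file] -/
theorem rankOne_posRoots_le_eight_of_condP (e d₀ d₁ d₂ d₃ : ℕ) (h01 : d₀ < d₁) (h1e : d₁ < e) (he2 : e < d₂) (h23 : d₂ < d₃)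
    (hB2 : d₁ + d₂ < 2 * e)
    (J : Matrix (Fin 2) (Fin 2) ℝ) (v₀ v₁ v₂ v₃ : Fin 2 → ℝ) (w₀ w₁ w₂ w₃ : ℝ) (hw₀ : 0 < w₀) (hw₁ : 0 < w₁) (hw₂ : 0 < w₂) (hw₃ : 0 < w₃)
    (hΔ₁₂ : v₁ 0 * v₂ 1 - v₁ 1 * v₂ 0 ≠ 0) (hΔ₂₃ : v₂ 0 * v₃ 1 - v₂ 1 * v₃ 0 ≠ 0)
    (hS : ((v₁ 0 * v₂ 1 - v₁ 1 * v₂ 0) ^ 2) * ((v₀ 0 * v₃ 1 - v₀ 1 * v₃ 0) ^ 2)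
        * (((d₁ : ℝ) + d₂ - e - d₀) * ((d₂ : ℝ) - e) * ((d₁ : ℝ) - d₀) * ((2 : ℝ) * e - d₁ - d₂) * ((e : ℝ) - d₁) * ((e : ℝ) + d₃ - d₁ - d₂) * ((d₃ : ℝ) - d₂))
        * (((d₃ : ℝ) - e) * ((d₀ : ℝ) + d₃ - e - d₁) * ((d₃ : ℝ) - d₂) * ((d₀ : ℝ) + d₃ - 2 * e) * ((e : ℝ) + d₂ - d₀ - d₃) * ((d₁ : ℝ) - d₀) * ((e : ℝ) - d₀))
        ≤ ((v₀ 0 * v₁ 1 - v₀ 1 * v₁ 0) ^ 2) * ((v₂ 0 * v₃ 1 - v₂ 1 * v₃ 0) ^ 2)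
        * (((2 : ℝ) * e - d₀ - d₁) * ((e : ℝ) - d₁) * ((e : ℝ) - d₀) * ((e : ℝ) + d₂ - d₀ - d₁) * ((e : ℝ) + d₃ - d₀ - d₁) * ((d₂ : ℝ) - d₁) * ((d₃ : ℝ) - d₀))
        * (((d₂ : ℝ) + d₃ - 2 * e) * ((d₂ : ℝ) + d₃ - e - d₀) * ((d₂ : ℝ) + d₃ - e - d₁) * ((d₃ : ℝ) - e) * ((d₂ : ℝ) - e) * ((d₃ : ℝ) - d₀) * ((d₂ : ℝ) - d₁))) :
    ((Matrix.det (((X : ℝ[X]) ^ e) • J.map Polynomial.C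
        + (Polynomial.C w₀ * X ^ d₀) • (vecMulVec v₀ v₀).map Polynomial.C
        + (Polynomial.C w₁ * X ^ d₁) • (vecMulVec v₁ v₁).map Polynomial.C
        + (Polynomial.C w₂ * X ^ d₂) • (vecMulVec v₂ v₂).map Polynomial.C
        + (Polynomial.C w₃ * X ^ d₃) • (vecMulVec v₃ v₃).map Polynomial.C)).roots.toFinset.filter (fun t => 0 < t)).card
      ≤ 8 := by
  rw [det_rankOne_four_sum]
  exact elevenNomial_condP_le_eight e d₀ d₁ d₂ d₃ h01 h1e he2 h23 hB2 J.det _ _ _ _ w₀ w₁ w₂ w₃ _ _ _ _ _ _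
    hw₀ hw₁ hw₂ hw₃ (by positivity) (by positivity) hS

end Summit.ValiantsHypothesis.ValiantsHypothesis.Theorems.LacunarySymmetroidMatrixDescartes.Pivot.TwoDirections.BlockLaw
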